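import Mathlib.Data.Pi.Interval
import Summits.HodgeConjecture.HodgeConjecture.Theorems.NikulinTwinTransportTwinTwistorTransportReduction
import Summits.HodgeConjecture.HodgeConjecture.Theorems.NikulinTwinTransportNikulinSerreCarrierBlockCriterionLattice
import Literature.AlgebraicGeometry.Surfaces.PolarisedK3TwinKuranishiFamily

/-!
# Route NikulinTwinTransport · crux `TwinTwistorTransport` (stmt-HodgeConjecture-14393) —
# line `reduced-virtual-count-twin-locus`, stub `stub_offWallStable` (off-wall is open on `D_h`)

The registered stub `stub_offWallStable` of
`Cruxes/TwinTwistorTransport/Lines/reduced_virtual_count_twin_locus.lean`, proved symbol for symbol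
(same local notations `Latt[M, N]`, `OffWall[M, h, x]` as the skeleton): for a rational lattice
`2`-similitude `M`, `h ∈ Λ` with `h² > 0` and `x₀ ∈ D_h = polarisedPeriodDomain h` off the walls of
the `h`-polarised `M`-twin family (no root `δ ⊥ h` and no `Mδ′ ⊥ h`, `δ′` a root, is `⊥ x₀`),
every `z ∈ D_h` close to `x₀` is off the walls — the local finiteness of the walls `δ^⊥`
(Huybrechts, *Lectures on K3 Surfaces*, Ch. 8 §2.2, Rem. 2.2 and Rem. 2.3: Ogus' argument, bounding
the coordinates of a root orthogonal to a nearby point in a frame adapted to a positive subspace).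

PROOF (linear algebra on `Λ_ℝ`, signature `(3, 19)`, and compactness of a sphere). `B` = the real
K3 form (`K3TwistorLines`); `(Re x₀, Im x₀, h)` is a `B`-orthogonal frame of positive vectors.
(1) `k3Real_wallHeight_neg`: the WALL HEIGHT `Q(w) = (w.w) − 2 Σ_{f ∈ frame} (w.f)²/(f.f)` equals
`(w⊥.w⊥) − (πw.πw)` (`π` = orthogonal projection onto the frame) and is `< 0` for `w ≠ 0`, because
`B` is negative definite on the orthogonal of a positive three-space (the tree's
`k3Real_eq_zero_of_perp_posThree`, Huybrechts Ch. 14 §0.3 (vi)). (2) `k3Real_uniform_neg_near`: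
`Q_z(w)` (frame `(Re z, Im z, h)`, constants of `x₀`) is jointly continuous and `2`-homogeneous in
`w`, so by compactness of the unit sphere there are `κ, r > 0` with `Q_z(w) ≤ −κ‖w‖²` for
`dist z x₀ < r`; for `w ⊥ Re z, Im z, h` this reads `(w.w) ≤ −κ‖w‖²`. (3) `twinWalls_finite_near`:
a wall vector (`δ`, square `−2`, or `Mδ′ ∈ (1/d)Λ`, square `−4`, `d` a common denominator of the
rational matrix of `M`, `twinLatt_exists_common_denominator`) orthogonal to some `z` with
`dist z x₀ < r` has `‖w‖² ≤ 4/κ`: finitely many. (4) `stub_offWallStable`: each of them has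
`(w.x₀) ≠ 0` by hypothesis, an open condition in `z`; finitely many open conditions.

References: [Huybrechts2016K3] Ch. 8 §2.2 Rem. 2.2, 2.3; Ch. 6 §1.1, §2.4 (`D`, `D_h`);
Ch. 14 §0.3 (vi) (signature `(3, 19)`).
-/

noncomputable section

set_option linter.dupNamespace false

open Literature.AlgebraicGeometry.Surfaces
open Summit.HodgeConjecture.HodgeConjecture.Theorems.NikulinSerreCarrier.NeronSeveriIntertwiner

namespace Summit.HodgeConjecture.HodgeConjecture.Theorems.NikulinTwinTransport

/-- `Latt[M, N]`: `M` is a rational `2`-similitude of `(Λ_ℂ, k3Form)` with rational two-sided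
inverse `N`. Local notation only, verbatim from the line skeleton. -/
local notation3 (prettyPrint := false) "Latt[" M ", " N "]" =>
  ((∀ v : K3Index → ℤ, ∃ w : K3Index → ℚ, M (fun i => (v i : ℂ)) = fun i => (w i : ℂ)) ∧
    (∀ v : K3Index → ℤ, ∃ w : K3Index → ℚ, N (fun i => (v i : ℂ)) = fun i => (w i : ℂ)) ∧
    M * N = 1 ∧ N * M = 1 ∧
    (∀ a b, k3Form (M a) (M b) = 2 * k3Form a b))

/-- `OffWall[M, h, x]`: the period `x` lies on none of the `(−2)`-walls of the `h`-polarised `M`-twin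
family (no root `δ ⊥ h` is `⊥ x`; no `Mδ′`, `δ′` a root with `Mδ′ ⊥ h`, is `⊥ x`). Local notation only,
verbatim from the line skeleton. -/
local notation3 (prettyPrint := false) "OffWall[" M ", " h ", " x "]" =>
  ((∀ δ : K3Index → ℤ, ∑ i, ∑ j, δ i * k3Gram i j * δ j = -2 →
      ∑ i, ∑ j, δ i * k3Gram i j * (h : K3Index → ℤ) j = 0 → k3Form (fun i => (δ i : ℂ)) x ≠ 0) ∧
    (∀ δ : K3Index → ℤ, ∑ i, ∑ j, δ i * k3Gram i j * δ j = -2 →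
      k3Form ((M : Module.End ℂ (K3Index → ℂ)) (fun i => (δ i : ℂ))) (fun i => ((h : K3Index → ℤ) i : ℂ)) = 0 →
      k3Form ((M : Module.End ℂ (K3Index → ℂ)) (fun i => (δ i : ℂ))) x ≠ 0))

/-- **The wall height is negative definite.** For the real K3 form `B` and a `B`-orthogonal frame
`(a, b, c)` of positive vectors, `Q(w) = (w.w) − 2((w.a)²/(a.a) + (w.b)²/(b.b) + (w.c)²/(c.c)) < 0`
for `w ≠ 0`: `Q(w) = (w⊥.w⊥) − (πw.πw)` for the orthogonal projection `π` onto `⟨a, b, c⟩`, and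
the orthogonal of a positive three-space is negative definite (`k3Real_eq_zero_of_perp_posThree`,
signature `(3, 19)`). [cite: Huybrechts2016K3, Ch. 8 §2.2 Rem. 2.3 and Ch. 14 §0.3 (vi)] -/
theorem k3Real_wallHeight_neg {B : LinearMap.BilinForm ℝ (K3Index → ℝ)}
    (hB : B = Matrix.toBilin' (k3Gram.map (Int.cast : ℤ → ℝ))) {a b c : K3Index → ℝ}
    (hab : B a b = 0) (hac : B a c = 0) (hbc : B b c = 0)
    (ha : 0 < B a a) (hb : 0 < B b b) (hc : 0 < B c c) {w : K3Index → ℝ} (hw : w ≠ 0) :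
    B w w - 2 * ((B w a) ^ 2 / B a a + (B w b) ^ 2 / B b b + (B w c) ^ 2 / B c c) < 0 := by
  have hBs : ∀ u w, B u w = B w u := fun u w => by rw [hB]; exact k3RForm_comm u w
  set α := B w a / B a a with hα
  set β := B w b / B b b with hβ
  set γ := B w c / B c c with hγ
  set v := w - α • a - β • b - γ • c with hv
  have hva : B v a = 0 := by
    rw [hv]; simp only [LinearMap.BilinForm.sub_left, LinearMap.BilinForm.smul_left]
    rw [hBs b a, hBs c a, hab, hac, hα, div_mul_cancel₀ _ ha.ne']; ring
  have hvb : B v b = 0 := by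
    rw [hv]; simp only [LinearMap.BilinForm.sub_left, LinearMap.BilinForm.smul_left]
    rw [hBs c b, hab, hbc, hβ, div_mul_cancel₀ _ hb.ne']; ring
  have hvc : B v c = 0 := by
    rw [hv]; simp only [LinearMap.BilinForm.sub_left, LinearMap.BilinForm.smul_left]
    rw [hac, hbc, hγ, div_mul_cancel₀ _ hc.ne']; ring
  have hw_eq : w = v + α • a + β • b + γ • c := by rw [hv]; module
  have hexp : B w w = B v v + α * α * B a a + β * β * B b b + γ * γ * B c c := by
    conv_lhs => rw [hw_eq]
    simp only [LinearMap.BilinForm.add_left, LinearMap.BilinForm.add_right,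
      LinearMap.BilinForm.smul_left, LinearMap.BilinForm.smul_right]
    rw [hBs a v, hBs b v, hBs c v, hva, hvb, hvc, hBs b a, hBs c a, hBs c b, hab, hac, hbc]
    ring
  have hsq : (B w a) ^ 2 / B a a + (B w b) ^ 2 / B b b + (B w c) ^ 2 / B c c =
      α * α * B a a + β * β * B b b + γ * γ * B c c := by
    simp only [hα, hβ, hγ]
    field_simp
  rw [hsq, hexp]
  have t0 : 0 ≤ α * α * B a a := mul_nonneg (mul_self_nonneg _) ha.le
  have t1 : 0 ≤ β * β * B b b := mul_nonneg (mul_self_nonneg _) hb.le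
  have t2 : 0 ≤ γ * γ * B c c := mul_nonneg (mul_self_nonneg _) hc.le
  by_cases hv0 : v = 0
  · -- `w = πw ≠ 0`: some coefficient is non-zero
    have hzero : ∀ {s t : ℝ}, 0 < t → s * s * t = 0 → s = 0 := fun ht h =>
      mul_self_eq_zero.1 ((mul_eq_zero.1 h).resolve_right ht.ne')
    have hS : 0 < α * α * B a a + β * β * B b b + γ * γ * B c c := by
      by_contra hle
      have hle := not_lt.mp hle
      have α0 : α = 0 := hzero ha (by linarith)
      have β0 : β = 0 := hzero hb (by linarith)
      have γ0 : γ = 0 := hzero hc (by linarith)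
      apply hw
      rw [hw_eq, hv0, α0, β0, γ0]
      simp
    rw [hv0, LinearMap.BilinForm.zero_left]
    linarith
  · -- `w⊥ ≠ 0` is orthogonal to the positive three-space `⟨a, b, c⟩`, hence `(w⊥.w⊥) < 0`
    have hneg : B v v < 0 := by
      by_contra hge
      refine hv0 (k3Real_eq_zero_of_perp_posThree hB ![a, b, c]
        (twistorChain_posFamily_of_orthogonal B hBs hab hac hbc ha hb hc) (fun i => ?_)
        (not_lt.mp hge))
      fin_cases i
      · simpa [hBs a v] using hva
      · simpa [hBs b v] using hvb
      · simpa [hBs c v] using hvc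
    linarith

open Topology Filter in
/-- **Uniform negativity near `x₀`.** For the real K3 form `B` and `x₀ ∈ Λ_ℂ`, `c ∈ Λ_ℝ` with
`(Re x₀, Im x₀, c)` a `B`-orthogonal frame of positive vectors (e.g. `x₀ ∈ D_h`, `c = h`), there are
`κ, r > 0` such that every real `w` orthogonal to `Re z`, `Im z`, `c`, for any `z` with
`dist z x₀ < r`, has `(w.w) ≤ −κ‖w‖²`: the wall height `Q_z(w)` (frame of `z`, constants of `x₀`)
is continuous in `(z, w)`, `2`-homogeneous in `w`, `< 0` on `{x₀} × (unit sphere)`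
(`k3Real_wallHeight_neg`), and the sphere is compact.
[cite: Huybrechts2016K3, Ch. 8 §2.2 Rem. 2.3] -/
theorem k3Real_uniform_neg_near {B : LinearMap.BilinForm ℝ (K3Index → ℝ)}
    (hB : B = Matrix.toBilin' (k3Gram.map (Int.cast : ℤ → ℝ)))
    {x₀ : K3Index → ℂ} {c : K3Index → ℝ}
    (hab : B (fun i => (x₀ i).re) (fun i => (x₀ i).im) = 0)
    (hac : B (fun i => (x₀ i).re) c = 0) (hbc : B (fun i => (x₀ i).im) c = 0)
    (ha : 0 < B (fun i => (x₀ i).re) (fun i => (x₀ i).re))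
    (hb : 0 < B (fun i => (x₀ i).im) (fun i => (x₀ i).im)) (hc : 0 < B c c) :
    ∃ κ : ℝ, 0 < κ ∧ ∃ r : ℝ, 0 < r ∧ ∀ z : K3Index → ℂ, dist z x₀ < r → ∀ w : K3Index → ℝ,
      B w (fun i => (z i).re) = 0 → B w (fun i => (z i).im) = 0 → B w c = 0 →
        B w w ≤ -κ * ‖w‖ ^ 2 := by
  -- the wall height `Q z w = (w.w) − 2((w.Re z)²/(Re x₀)² + (w.Im z)²/(Im x₀)² + (w.c)²/(c.c))`
  set Q : (K3Index → ℂ) → (K3Index → ℝ) → ℝ := fun z w =>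
    B w w - 2 * ((B w (fun i => (z i).re)) ^ 2 / B (fun i => (x₀ i).re) (fun i => (x₀ i).re) +
      (B w (fun i => (z i).im)) ^ 2 / B (fun i => (x₀ i).im) (fun i => (x₀ i).im) +
      (B w c) ^ 2 / B c c) with hQ
  have hcont : Continuous fun p : (K3Index → ℂ) × (K3Index → ℝ) => Q p.1 p.2 := by
    simp only [hQ, hB, k3RForm_apply]
    fun_prop
  have hneg : ∀ w : K3Index → ℝ, w ≠ 0 → Q x₀ w < 0 := fun w hw =>
    k3Real_wallHeight_neg hB hab hac hbc ha hb hc hw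
  have hhom : ∀ z (t : ℝ) w, Q z (t • w) = t ^ 2 * Q z w := by
    intro z t w
    simp only [hQ, LinearMap.BilinForm.smul_left, LinearMap.BilinForm.smul_right]
    ring
  -- the unit sphere of `Λ_ℝ` is compact and non-empty; `Q x₀ ≤ −2κ < −κ` on it
  have hS : IsCompact (Metric.sphere (0 : K3Index → ℝ) 1) := isCompact_sphere 0 1
  have hSne : (Metric.sphere (0 : K3Index → ℝ) 1).Nonempty := ⟨fun _ => 1, by simp⟩
  obtain ⟨w₀, hw₀S, hmax⟩ :=
    hS.exists_isMaxOn hSne (hcont.comp (Continuous.prodMk_right x₀)).continuousOn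
  have hw₀ : w₀ ≠ 0 := by
    rintro rfl
    rw [mem_sphere_zero_iff_norm, norm_zero] at hw₀S
    exact zero_ne_one hw₀S
  set κ : ℝ := -(Q x₀ w₀) / 2 with hκ
  have hκ0 : 0 < κ := by have := hneg w₀ hw₀; rw [hκ]; linarith
  -- hence `Q z < −κ` on the sphere for `z` near `x₀`
  have hev : ∀ᶠ z in 𝓝 x₀, ∀ w ∈ Metric.sphere (0 : K3Index → ℝ) 1, Q z w < -κ := by
    refine hS.eventually_forall_of_forall_eventually fun w hw => ?_
    have hle : Q x₀ w ≤ Q x₀ w₀ := hmax hw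
    have hlt : Q x₀ w < -κ := by have := hneg w₀ hw₀; rw [hκ]; linarith
    exact (hcont.tendsto (x₀, w)).eventually (eventually_lt_nhds hlt)
  obtain ⟨r, hr, hball⟩ := Metric.eventually_nhds_iff.1 hev
  refine ⟨κ, hκ0, r, hr, fun z hz w hwa hwb hwc => ?_⟩
  have hQw : Q z w = B w w := by simp only [hQ, hwa, hwb, hwc]; ring
  rw [← hQw]
  by_cases hw : w = 0
  · have h0 : Q z w = 0 := by simp [hQ, hw]
    rw [h0, hw, norm_zero]
    linarith
  · -- `2`-homogeneity
    have hn : 0 < ‖w‖ := norm_pos_iff.2 hw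
    have hunit : ‖w‖⁻¹ • w ∈ Metric.sphere (0 : K3Index → ℝ) 1 := by
      rw [mem_sphere_zero_iff_norm, norm_smul, norm_inv, norm_norm, inv_mul_cancel₀ hn.ne']
    have hw_eq : ‖w‖ • (‖w‖⁻¹ • w) = w := by rw [smul_smul, mul_inv_cancel₀ hn.ne', one_smul]
    calc Q z w = Q z (‖w‖ • (‖w‖⁻¹ • w)) := by rw [hw_eq]
      _ = ‖w‖ ^ 2 * Q z (‖w‖⁻¹ • w) := hhom z ‖w‖ _
      _ ≤ ‖w‖ ^ 2 * (-κ) := mul_le_mul_of_nonneg_left (hball hz _ hunit).le (sq_nonneg _)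
      _ = -κ * ‖w‖ ^ 2 := by ring

/-- **A rational lattice map has a common denominator**: if the `ℂ`-linear `M` maps `Λ` into
`Λ_ℚ` (first clause of `Latt[M, N]`), some integer `d ≠ 0` has `M(Λ) ⊆ (1/d)Λ` — the matrix of
`M` on the integral basis is rational, with finitely many denominators
(`IsLocalization.exist_integer_multiples_of_finite`). [folklore] -/
theorem twinLatt_exists_common_denominator (M : Module.End ℂ (K3Index → ℂ))
    (hM : ∀ v : K3Index → ℤ, ∃ w : K3Index → ℚ, M (fun i => (v i : ℂ)) = fun i => (w i : ℂ)) :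
    ∃ d : ℤ, d ≠ 0 ∧ ∀ v : K3Index → ℤ, ∃ m : K3Index → ℤ,
      M (fun i => (v i : ℂ)) = fun i => (((m i : ℝ) / (d : ℝ) : ℝ) : ℂ) := by
  classical
  choose q hq using fun j : K3Index => hM (Pi.single j 1)
  obtain ⟨⟨d, hd⟩, hint⟩ := IsLocalization.exist_integer_multiples_of_finite (nonZeroDivisors ℤ)
    (fun p : K3Index × K3Index => q p.1 p.2)
  have hd0 : d ≠ 0 := nonZeroDivisors.ne_zero hd
  choose z hz using fun p : K3Index × K3Index => RingHom.mem_rangeS.1 (hint p)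
  have hzq : ∀ j i, (q j i : ℂ) = (z (j, i) : ℂ) / (d : ℂ) := by
    intro j i
    have h := hz (j, i)
    simp only [algebraMap_int_eq, Int.coe_castRingHom, zsmul_eq_mul] at h
    rw [eq_div_iff (by exact_mod_cast hd0 : (d : ℂ) ≠ 0), mul_comm]
    have := congrArg (fun r : ℚ => (r : ℂ))
      (show ((d : ℚ) * q j i : ℚ) = (z (j, i) : ℚ) from h.symm)
    push_cast at this
    exact this
  refine ⟨d, hd0, fun v => ⟨fun i => ∑ j, v j * z (j, i), ?_⟩⟩
  have hv : (fun i => (v i : ℂ)) =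
      ∑ j, (v j : ℂ) • fun i => ((Pi.single j (1 : ℤ) : K3Index → ℤ) i : ℂ) := by
    funext i
    simp [Finset.sum_apply, Pi.single_apply]
  rw [hv, map_sum]
  funext i
  simp only [map_smul, hq, Finset.sum_apply, Pi.smul_apply, smul_eq_mul, hzq]
  push_cast
  rw [Finset.sum_div]
  exact Finset.sum_congr rfl fun j _ => (mul_div_assoc _ _ _).symm

/-- **Wall vectors orthogonal to points near `x₀` form a finite set** (the heart of "walls are
locally finite", for both wall families of the `h`-polarised `M`-twin family): for `M` rational on
`Λ` with `(Ma.Mb) = 2(a.b)`, `h² > 0` and `x₀ ∈ D_h`, there are `r > 0` and a FINITE `F ⊂ Λ_ℂ`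
containing every root `δ ⊥ h` and every `Mδ′ ⊥ h` (`δ′` a root) orthogonal to some `z` with
`dist z x₀ < r`: such a vector is real, orthogonal to `Re z, Im z, h`, of square `−2` resp. `−4`,
so `‖w‖² ≤ 4/κ` (`k3Real_uniform_neg_near`), and `δ`, resp. `d·Mδ′`, is a lattice vector in a
bounded box. [cite: Huybrechts2016K3, Ch. 8 §2.2 Rem. 2.2 and Rem. 2.3] -/
theorem twinWalls_finite_near (M : Module.End ℂ (K3Index → ℂ))
    (hMrat : ∀ v : K3Index → ℤ, ∃ w : K3Index → ℚ, M (fun i => (v i : ℂ)) = fun i => (w i : ℂ))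
    (hMiso : ∀ a b, k3Form (M a) (M b) = 2 * k3Form a b)
    {h : K3Index → ℤ} (hh : 0 < ∑ i, ∑ j, h i * k3Gram i j * h j)
    {x₀ : K3Index → ℂ} (hx₀ : x₀ ∈ polarisedPeriodDomain h) :
    ∃ r : ℝ, 0 < r ∧ ∃ F : Set (K3Index → ℂ), F.Finite ∧
      (∀ δ : K3Index → ℤ, ∑ i, ∑ j, δ i * k3Gram i j * δ j = -2 →
        ∑ i, ∑ j, δ i * k3Gram i j * h j = 0 →
        ∀ z : K3Index → ℂ, dist z x₀ < r → k3Form (fun i => (δ i : ℂ)) z = 0 →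
          (fun i => (δ i : ℂ)) ∈ F) ∧
      (∀ δ : K3Index → ℤ, ∑ i, ∑ j, δ i * k3Gram i j * δ j = -2 →
        k3Form (M (fun i => (δ i : ℂ))) (fun i => (h i : ℂ)) = 0 →
        ∀ z : K3Index → ℂ, dist z x₀ < r → k3Form (M (fun i => (δ i : ℂ))) z = 0 →
          M (fun i => (δ i : ℂ)) ∈ F) := by
  classical
  set B : LinearMap.BilinForm ℝ (K3Index → ℝ) := Matrix.toBilin' (k3Gram.map (Int.cast : ℤ → ℝ))
    with hB
  have hBs : ∀ u w, B u w = B w u := fun u w => by rw [hB]; exact k3RForm_comm u w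
  have hBZ : ∀ u w : K3Index → ℤ, B (fun i => (u i : ℝ)) (fun i => (w i : ℝ)) =
      ((∑ i, ∑ j, u i * k3Gram i j * w j : ℤ) : ℝ) := fun u w => by
    rw [hB, k3RForm_apply]; push_cast; rfl
  -- the positive frame `(Re x₀, Im x₀, h)` of `x₀ ∈ D_h`
  set c : K3Index → ℝ := fun i => (h i : ℝ) with hc_def
  have hcC : (fun i => (h i : ℂ)) = fun i => ((c i : ℝ) : ℂ) := by funext i; simp [hc_def]
  obtain ⟨hxx, hpos, hhx⟩ := hx₀
  obtain ⟨hab, haabb, ha⟩ := (mem_k3PeriodDomain_iff_k3RForm hB x₀).1 ⟨hxx, hpos⟩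
  have hb : 0 < B (fun i => (x₀ i).im) (fun i => (x₀ i).im) := haabb ▸ ha
  have hc : 0 < B c c := by rw [hc_def, hBZ]; exact_mod_cast hh
  rw [hcC] at hhx
  obtain ⟨hca, hcb⟩ := k3Real_orthogonal_re_im hhx
  obtain ⟨κ, hκ, r, hr, hunif⟩ := k3Real_uniform_neg_near hB hab (by rw [hBs]; exact hca)
    (by rw [hBs]; exact hcb) ha hb hc
  -- the coordinate bound for orthogonal vectors of square `≥ −4`, and integral boxes
  set R : ℝ := Real.sqrt (4 / κ) with hR
  have hbound : ∀ z : K3Index → ℂ, dist z x₀ < r → ∀ u : K3Index → ℝ,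
      B u (fun i => (z i).re) = 0 → B u (fun i => (z i).im) = 0 → B u c = 0 → -4 ≤ B u u →
        ∀ i, |u i| ≤ R := by
    intro z hz u h1 h2 h3 h4 i
    have hle := hunif z hz u h1 h2 h3
    have hsq : ‖u‖ ^ 2 ≤ 4 / κ := by rw [le_div_iff₀ hκ]; nlinarith
    have hi : |u i| ≤ ‖u‖ := by simpa only [Real.norm_eq_abs] using norm_le_pi_norm u i
    exact Real.abs_le_sqrt
      (((sq_abs _).symm.trans_le (pow_le_pow_left₀ (abs_nonneg _) hi 2)).trans hsq)
  have hbox : ∀ {t : ℝ} {k : ℤ}, |(k : ℝ)| ≤ t → -⌈t⌉ ≤ k ∧ k ≤ ⌈t⌉ := fun {t k} hk => by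
    have h₁ := (abs_le.1 hk).1; have h₂ := (abs_le.1 hk).2; have h₃ := Int.le_ceil t
    exact ⟨by exact_mod_cast (show (-(⌈t⌉ : ℝ)) ≤ (k : ℝ) by linarith),
      by exact_mod_cast (show (k : ℝ) ≤ (⌈t⌉ : ℝ) by linarith)⟩
  obtain ⟨d, hd, hden⟩ := twinLatt_exists_common_denominator M hMrat
  set F₁ : Set (K3Index → ℂ) := (fun m : K3Index → ℤ => fun i => (m i : ℂ)) ''
    Set.Icc (fun _ => -⌈R⌉) (fun _ => ⌈R⌉) with hF₁
  set F₂ : Set (K3Index → ℂ) := (fun m : K3Index → ℤ => fun i => (((m i : ℝ) / (d : ℝ) : ℝ) : ℂ)) ''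
    Set.Icc (fun _ => -⌈|(d : ℝ)| * R⌉) (fun _ => ⌈|(d : ℝ)| * R⌉) with hF₂
  refine ⟨r, hr, F₁ ∪ F₂, ((Set.finite_Icc _ _).image _).union ((Set.finite_Icc _ _).image _),
    ?_, ?_⟩
  · -- roots `δ ⊥ h` orthogonal to a nearby `z`: `δ` lies in the box of size `⌈R⌉`
    intro δ hδ hδh z hz h0
    set u : K3Index → ℝ := fun i => (δ i : ℝ) with hu_def
    have huC : (fun i => (δ i : ℂ)) = fun i => ((u i : ℝ) : ℂ) := by funext i; simp [hu_def]
    rw [huC] at h0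
    obtain ⟨h1, h2⟩ := k3Real_orthogonal_re_im h0
    have h3 : B u c = 0 := by rw [hu_def, hc_def, hBZ, hδh, Int.cast_zero]
    have h4 : -4 ≤ B u u := by rw [hu_def, hBZ, hδ]; norm_num
    have hi := hbound z hz u h1 h2 h3 h4
    exact Or.inl ⟨δ, ⟨fun i => (hbox (hi i)).1, fun i => (hbox (hi i)).2⟩, rfl⟩
  · -- vectors `Mδ′ ⊥ h`, `δ′` a root, orthogonal to a nearby `z`: `d • Mδ′` lies in a box
    intro δ hδ hδh z hz h0
    obtain ⟨m, hm⟩ := hden δ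
    set u : K3Index → ℝ := fun i => (m i : ℝ) / (d : ℝ) with hu_def
    have hmC : M (fun i => (δ i : ℂ)) = fun i => ((u i : ℝ) : ℂ) := hm
    rw [hmC] at h0 hδh
    obtain ⟨h1, h2⟩ := k3Real_orthogonal_re_im h0
    have h3 : B u c = 0 := by
      rw [hcC, k3Form_ofReal_eq_k3RForm] at hδh
      exact_mod_cast hδh
    have h4 : -4 ≤ B u u := by
      have hsq := hMiso (fun i => (δ i : ℂ)) (fun i => (δ i : ℂ))
      rw [hmC, k3Form_ofReal_eq_k3RForm, k3Form_intCast, hδ] at hsq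
      have : ((B u u : ℝ) : ℂ) = ((-4 : ℝ) : ℂ) := by rw [hsq]; push_cast; ring
      rw [show B u u = -4 by exact_mod_cast this]
    have hi := hbound z hz u h1 h2 h3 h4
    have hmi : ∀ i, |(m i : ℝ)| ≤ |(d : ℝ)| * R := fun i => by
      have hmu : (m i : ℝ) = (d : ℝ) * u i := by
        have hd' : (d : ℝ) ≠ 0 := by exact_mod_cast hd
        simp only [hu_def]; field_simp
      rw [hmu, abs_mul]
      exact mul_le_mul_of_nonneg_left (hi i) (abs_nonneg _)
    exact Or.inr ⟨m, ⟨fun i => (hbox (hmi i)).1, fun i => (hbox (hmi i)).2⟩, hm.symm ▸ rfl⟩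

open Topology Filter in
/-- **`OffWallStable` — registered stub `stub_offWallStable` of the line
`reduced-virtual-count-twin-locus`, proved: off-wall is an open condition on `D_h`.** For a rational
lattice `2`-similitude `M` (`Latt[M, N]`), `h ∈ Λ` with `h² > 0` and `x₀ ∈ D_h` off the walls
(`OffWall[M, h, x₀]`), there is `ε > 0` such that every `z ∈ D_h` with `dist z x₀ < ε` is off the
walls. Proof: the wall vectors orthogonal to SOME point near `x₀` form a finite set `F`
(`twinWalls_finite_near`); each `w ∈ F` of wall type has `(w.x₀) ≠ 0` by hypothesis, an open
condition in `z` (`ContinuousAt.eventually_ne`, `Set.Finite.eventually_all`); in the resulting ball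
a wall vector orthogonal to `z` would lie in `F` — contradiction (Huybrechts Ch. 8 §2.2 Rem. 2.2:
the union of the walls `δ^⊥` is closed, hence locally finite; Rem. 2.3, Ogus' argument).
[cite: Huybrechts2016K3, Ch. 8 §2.2 Rem. 2.2 and Rem. 2.3; Ch. 6 §2.4 (`D_h`)] -/
theorem stub_offWallStable :
    ∀ (M N : Module.End ℂ (K3Index → ℂ)), Latt[M, N] →
      ∀ (h : K3Index → ℤ), 0 < ∑ i, ∑ j, h i * k3Gram i j * h j →
        ∀ x₀ ∈ polarisedPeriodDomain h, OffWall[M, h, x₀] →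
          ∃ ε : ℝ, 0 < ε ∧ ∀ z ∈ polarisedPeriodDomain h, dist z x₀ < ε → OffWall[M, h, z] := by
  intro M N hL h hh x₀ hx₀ hoff
  obtain ⟨hMrat, -, -, -, hMiso⟩ := hL
  obtain ⟨r, hr, F, hF, hF₁, hF₂⟩ := twinWalls_finite_near M hMrat hMiso hh hx₀
  -- the wall vectors of the `h`-polarised `M`-twin family
  set W : Set (K3Index → ℂ) :=
    {w | ∃ δ : K3Index → ℤ, ∑ i, ∑ j, δ i * k3Gram i j * δ j = -2 ∧
        ∑ i, ∑ j, δ i * k3Gram i j * h j = 0 ∧ w = fun i => (δ i : ℂ)} ∪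
    {w | ∃ δ : K3Index → ℤ, ∑ i, ∑ j, δ i * k3Gram i j * δ j = -2 ∧
        k3Form (M (fun i => (δ i : ℂ))) (fun i => (h i : ℂ)) = 0 ∧ w = M (fun i => (δ i : ℂ))}
    with hW
  have hWx₀ : ∀ w ∈ W, k3Form w x₀ ≠ 0 := by
    rintro w (⟨δ, hδ, hδh, rfl⟩ | ⟨δ, hδ, hδh, rfl⟩)
    exacts [hoff.1 δ hδ hδh, hoff.2 δ hδ hδh]
  have hWF : ∀ w ∈ W, ∀ z, dist z x₀ < r → k3Form w z = 0 → w ∈ F := by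
    rintro w (⟨δ, hδ, hδh, rfl⟩ | ⟨δ, hδ, hδh, rfl⟩) z hz h0
    exacts [hF₁ δ hδ hδh z hz h0, hF₂ δ hδ hδh z hz h0]
  -- finitely many open conditions `(w.z) ≠ 0`, `w ∈ F ∩ W`
  have hev₁ : ∀ᶠ z in 𝓝 x₀, ∀ w ∈ F ∩ W, k3Form w z ≠ 0 := by
    refine (hF.inter_of_left W).eventually_all.2 fun w hw => ?_
    have hcont : Continuous fun z : K3Index → ℂ => k3Form w z := by
      simp only [k3Form]
      fun_prop
    exact hcont.continuousAt.eventually_ne (hWx₀ w hw.2)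
  have hev₂ : ∀ᶠ z in 𝓝 x₀, dist z x₀ < r := Metric.ball_mem_nhds x₀ hr
  obtain ⟨ε, hε, hεP⟩ := Metric.eventually_nhds_iff.1 (hev₁.and hev₂)
  refine ⟨ε, hε, fun z _ hz => ?_⟩
  obtain ⟨hP₁, hP₂⟩ := hεP hz
  have key : ∀ w ∈ W, k3Form w z ≠ 0 := fun w hw h0 => hP₁ w ⟨hWF w hw z hP₂ h0, hw⟩ h0
  exact ⟨fun δ hδ hδh => key _ (Or.inl ⟨δ, hδ, hδh, rfl⟩),
    fun δ hδ hδh => key _ (Or.inr ⟨δ, hδ, hδh, rfl⟩)⟩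

end Summit.HodgeConjecture.HodgeConjecture.Theorems.NikulinTwinTransport

end
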